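import Literature.NumberTheory.Transcendental.KZCubeRationalMoves
import Summits.KontsevichZagierPeriods.KontsevichZagierPeriods.Theorems.HurwitzMicroSectorsNormalFormPrincipleDimOneAssembly

/-!
# `NormalFormPrinciple` (stmt-KontsevichZagierPeriods-3869), line `SketchIdeator1` — leaf `stub_boxRigidity`:
# the STOKES-EXACT LAYER in dimension two (rule 3 enters), unconditionally

Pure proof file (lead seat c8; `--supports` the crux). A second mechanism after this seat's
rule-(2)-only layers (`FiveZetaTwoOffProduct`, `CatalanTwoWays`, the cyclotomic log layer): the
Newton–Leibniz / Stokes move. For a regular rational function `T = P/Q` on the closed square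
(`Q ≠ 0` on `[0,1]²`; Literature's `KZ.RFun 2`), the square representation of a partial derivative
`[[0,1]², ∂ᵢ T]` is, by ONE Stokes move of Ayoub's cubical calculus (Literature
`KZ.RFun.stokesAt`, an instance of Kontsevich–Zagier's rule (3)), congruent to the difference of the
two faces `[[0,1], T|_{xᵢ=1}] − [[0,1], T|_{xᵢ=0}]`, which are representations of KZ's RATIONAL shape
in dimension one; and Conjecture 1 in dimension `≤ 1` is a THEOREM for all rational representations
(seat c4, `PiBox.Dlog.mem_relations_of_eval_eq_zero_of_dim_le_one`, via Baker). Hence: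

* `stokes_mem_relations_of_eval_eq_zero_of_mem_closure` — **Conjecture 1, kernel form, on the
  subgroup generated by all Stokes-exact square representations `[[0,1]², ∂ᵢ(P/Q)]` (`i = 0, 1`)
  together with ALL rational representations of dimension `≤ 1`**, unconditionally;
* two-representation corollaries: two Stokes-exact squares with equal values are KZ-equivalent
  (`stokesExact_equivalent_of_value_eq`); a Stokes-exact square against any rational representation
  of dimension `≤ 1` (`stokesExact_equivalent_dimLeOne_of_value_eq`); and the same for
  representations on the OPEN box `(0,1)²` whose integrand agrees there with `∂ᵢ(P/Q)`
  (`box_stokesExact_equivalent_dimLeOne_of_value_eq`), e.g. `[(0,1)², 1/(1+x+y)²] ~ [(1, 4/3), 1/t]`.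

Values covered: those of rational one-forms on `[0,1]` without poles on the closed interval
(`ℚ`-combinations of logarithms of algebraic numbers, `π` times algebraic numbers, rationals).
References: M. Kontsevich, D. Zagier, *Periods* (2001), §1.2 (rule (3), Conjecture 1);
J. Ayoub, *Une version relative de la conjecture des périodes de Kontsevich–Zagier* (2014), Def. 10.
No definitions are introduced.
-/

noncomputable section

open MeasureTheory Set
open Literature.NumberTheory.Transcendental Literature.NumberTheory.Transcendental.KZ
open Literature.ModelTheory.ExponentialFields (IsSemialgebraic)

namespace Summit.KontsevichZagierPeriods.HurwitzMicroSectors.NormalFormPrinciple.PiBox.Stokes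

open Summit.KontsevichZagierPeriods.HurwitzMicroSectors.NormalFormPrinciple.PiBox.Dlog
  (mem_relations_of_eval_eq_zero_of_dim_le_one)

/-- The cube representation of a regular rational function has KZ's rational shape. [folklore] -/
theorem isRational_rep {M : ℕ} (T : RFun M) : T.rep.IsRational :=
  ⟨T.num, T.den, T.den_ne, fun _ _ => rfl⟩

/-- **A Stokes-exact square is congruent to an element of the dimension-`≤ 1` subgroup**: by one
Stokes move `[[0,1]², ∂ᵢT] ≡ [[0,1], T|_{xᵢ=1}] − [[0,1], T|_{xᵢ=0}]` (`KZ.RFun.stokesAt`), and both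
faces are rational representations of dimension `1`. [cite: KontsevichZagier2001, §1.2 rule (3)] -/
theorem exists_mem_dimLeOneClosure_sub_of_stokesExact (i : Fin 2) (T : RFun 2) :
    ∃ x' ∈ AddSubgroup.closure
        {y : FormalRep | ∃ (m : ℕ) (N : IntegralRep m), m ≤ 1 ∧ N.IsRational ∧ y = of N},
      of (T.pd i).rep - x' ∈ relations := by
  refine ⟨of (T.faceAt i 1 ⟨zero_le_one, le_rfl⟩).rep - of (T.faceAt i 0 ⟨le_rfl, zero_le_one⟩).rep,
    AddSubgroup.sub_mem _ (AddSubgroup.subset_closure ⟨1, _, le_rfl, isRational_rep _, rfl⟩)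
      (AddSubgroup.subset_closure ⟨1, _, le_rfl, isRational_rep _, rfl⟩), ?_⟩
  exact RFun.stokesAt i T

/-- **Every element of the enlarged subgroup differs by relations from an element of the
dimension-`≤ 1` subgroup.** [cite: KontsevichZagier2001, §1.2] -/
theorem exists_mem_dimLeOneClosure_of_mem_stokesClosure {x : FormalRep}
    (hx : x ∈ AddSubgroup.closure
      ({y : FormalRep | ∃ (i : Fin 2) (T : RFun 2), y = of (T.pd i).rep} ∪
       {y : FormalRep | ∃ (m : ℕ) (N : IntegralRep m), m ≤ 1 ∧ N.IsRational ∧ y = of N})) :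
    ∃ x' ∈ AddSubgroup.closure
        {y : FormalRep | ∃ (m : ℕ) (N : IntegralRep m), m ≤ 1 ∧ N.IsRational ∧ y = of N},
      x - x' ∈ relations := by
  induction hx using AddSubgroup.closure_induction with
  | mem y hy =>
    rcases hy with hy | hy
    · obtain ⟨i, T, rfl⟩ := hy
      exact exists_mem_dimLeOneClosure_sub_of_stokesExact i T
    · exact ⟨y, AddSubgroup.subset_closure hy, by simp [relations.zero_mem]⟩
  | zero => exact ⟨0, AddSubgroup.zero_mem _, by simp [relations.zero_mem]⟩
  | add y z _ _ ihy ihz =>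
    obtain ⟨y', hy', ey⟩ := ihy
    obtain ⟨z', hz', ez⟩ := ihz
    refine ⟨y' + z', AddSubgroup.add_mem _ hy' hz', ?_⟩
    have e : y + z - (y' + z') = (y - y') + (z - z') := by abel
    rw [e]
    exact relations.add_mem ey ez
  | neg y _ ihy =>
    obtain ⟨y', hy', ey⟩ := ihy
    refine ⟨-y', AddSubgroup.neg_mem _ hy', ?_⟩
    have e : -y - -y' = -(y - y') := by abel
    rw [e]
    exact relations.neg_mem ey

/-- **Conjecture 1 of Kontsevich–Zagier, kernel form, on the subgroup generated by all STOKES-EXACT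
square representations `[[0,1]², ∂ᵢ(P/Q)]` (`Q ≠ 0` on the closed square, `i = 0, 1`) together with
ALL rational representations of dimension `≤ 1`** — unconditionally: a formal `ℤ`-combination with
value `0` is a relation. One Stokes move per square (rule 3), then Baker in dimension `≤ 1` (seat c4).
[cite: KontsevichZagier2001, §1.2 Conjecture 1] -/
theorem stokes_mem_relations_of_eval_eq_zero_of_mem_closure {x : FormalRep}
    (hx : x ∈ AddSubgroup.closure
      ({y : FormalRep | ∃ (i : Fin 2) (T : RFun 2), y = of (T.pd i).rep} ∪
       {y : FormalRep | ∃ (m : ℕ) (N : IntegralRep m), m ≤ 1 ∧ N.IsRational ∧ y = of N}))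
    (hv : eval x = 0) : x ∈ relations := by
  obtain ⟨x', hx', e⟩ := exists_mem_dimLeOneClosure_of_mem_stokesClosure hx
  have h0 : eval x' = 0 := by
    have h := relations_le_ker_eval_holds e
    rw [AddMonoidHom.mem_ker, map_sub, hv, zero_sub, neg_eq_zero] at h
    exact h
  have hx'r := mem_relations_of_eval_eq_zero_of_dim_le_one hx' h0
  have e' : x = (x - x') + x' := by abel
  rw [e']
  exact relations.add_mem e hx'r

/-- **Two Stokes-exact squares with equal values are KZ-equivalent.**
[cite: KontsevichZagier2001, §1.2 Conjecture 1] -/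
theorem stokesExact_equivalent_of_value_eq (i j : Fin 2) (T S : RFun 2)
    (hv : (T.pd i).rep.value = (S.pd j).rep.value) : Equivalent (T.pd i).rep (S.pd j).rep := by
  refine stokes_mem_relations_of_eval_eq_zero_of_mem_closure (AddSubgroup.sub_mem _
    (AddSubgroup.subset_closure (Or.inl ⟨i, T, rfl⟩))
    (AddSubgroup.subset_closure (Or.inl ⟨j, S, rfl⟩))) ?_
  rw [map_sub, eval_of, eval_of, hv, sub_self]

/-- **A Stokes-exact square against ANY rational representation of dimension `≤ 1`** (a rational
point, an interval integral `∫ₐᵇ p/q`, …): equal values imply KZ-equivalence.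
[cite: KontsevichZagier2001, §1.2 Conjecture 1] -/
theorem stokesExact_equivalent_dimLeOne_of_value_eq {m : ℕ} (hm : m ≤ 1) (i : Fin 2) (T : RFun 2)
    (N : IntegralRep m) (hN : N.IsRational) (hv : (T.pd i).rep.value = N.value) :
    Equivalent (T.pd i).rep N := by
  refine stokes_mem_relations_of_eval_eq_zero_of_mem_closure (AddSubgroup.sub_mem _
    (AddSubgroup.subset_closure (Or.inl ⟨i, T, rfl⟩))
    (AddSubgroup.subset_closure (Or.inr ⟨m, N, hm, hN, rfl⟩))) ?_
  rw [map_sub, eval_of, eval_of, hv, sub_self]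

/-! ### The same on the open box `(0,1)²` (null boundary) -/

/-- The closed square minus the open box is Lebesgue-null (four edges). [folklore] -/
theorem volume_cube_diff_box :
    volume (KZ.cube 2 \ {x : Fin 2 → ℝ | ∀ i, x i ∈ Set.Ioo (0:ℝ) 1}) = 0 := by
  have hsub : KZ.cube 2 \ {x : Fin 2 → ℝ | ∀ i, x i ∈ Set.Ioo (0:ℝ) 1} ⊆
      ⋃ i : Fin 2, ({x : Fin 2 → ℝ | x i = 0} ∪ {x | x i = 1}) := by
    intro x hx
    obtain ⟨hc, hb⟩ := hx
    simp only [mem_setOf_eq, not_forall] at hb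
    obtain ⟨i, hi⟩ := hb
    have h0 := (hc i).1
    have h1 := (hc i).2
    refine mem_iUnion.2 ⟨i, ?_⟩
    rcases h0.eq_or_lt with h | h
    · exact Or.inl h.symm
    rcases h1.lt_or_eq with h' | h'
    · exact absurd ⟨h, h'⟩ hi
    · exact Or.inr h'
  refine measure_mono_null hsub ((measure_iUnion_null_iff).2 fun i => measure_union_null ?_ ?_)
  · exact Measure.pi_hyperplane (fun _ => (volume : Measure ℝ)) i 0
  · exact Measure.pi_hyperplane (fun _ => (volume : Measure ℝ)) i 1

/-- **An open-box representation whose integrand agrees on `(0,1)²` with a Stokes-exact regular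
rational function is congruent to the Stokes-exact square** (the boundary is null, rule 1).
[cite: KontsevichZagier2001, §1.2 rule (1)] -/
theorem of_box_sub_of_stokesExact_mem_relations (i : Fin 2) (T : RFun 2) (N : IntegralRep 2)
    (hNd : N.domain = {x | ∀ i, x i ∈ Set.Ioo (0:ℝ) 1})
    (hNi : EqOn N.integrand (T.pd i).fn N.domain) :
    of N - of (T.pd i).rep ∈ relations := by
  refine of_sub_of_mem_relations_of_null N (T.pd i).rep ?_ ?_ fun x hx => ?_
  · rw [hNd, RFun.rep_domain]
    refine measure_mono_null (fun x hx => ?_) (measure_empty (μ := (volume : Measure (Fin 2 → ℝ))))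
    exact (hx.2 fun i => ⟨(hx.1 i).1.le, (hx.1 i).2.le⟩).elim
  · rw [hNd, RFun.rep_domain]
    exact volume_cube_diff_box
  · rw [RFun.rep_integrand, hNi hx.1]

/-- **Conjecture 1 for an open-box representation with a Stokes-exact integrand against any rational
representation of dimension `≤ 1`.** For `P, Q ∈ ℚ[x₀,x₁]` with `Q ≠ 0` on the closed square and
`N` on the open box `(0,1)²` with integrand agreeing there with
`∂ᵢ(P/Q) = (∂ᵢP·Q − P·∂ᵢQ)/Q²`, and any rational `N'` of dimension `m ≤ 1` of the same value:
`KZ.Equivalent N N'`. Example: `[(0,1)², 1/(1+x+y)²]` (`= ∂₁(−1/(1+x+y))`, value `log(4/3)`) against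
`[(1, 4/3), 1/t]`. [cite: KontsevichZagier2001, §1.2 Conjecture 1] -/
theorem box_stokesExact_equivalent_dimLeOne_of_value_eq {m : ℕ} (hm : m ≤ 1) (i : Fin 2)
    (P Q : MvPolynomial (Fin 2) ℚ) (hQ : ∀ x ∈ KZ.cube 2, MvPolynomial.aeval x Q ≠ 0)
    (N : IntegralRep 2) (hNd : N.domain = {x | ∀ i, x i ∈ Set.Ioo (0:ℝ) 1})
    (hNi : EqOn N.integrand (fun x =>
      (MvPolynomial.aeval x (MvPolynomial.pderiv i P) * MvPolynomial.aeval x Q -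
        MvPolynomial.aeval x P * MvPolynomial.aeval x (MvPolynomial.pderiv i Q)) /
      (MvPolynomial.aeval x Q) ^ 2) N.domain)
    (N' : IntegralRep m) (hN' : N'.IsRational) (hv : N.value = N'.value) : Equivalent N N' := by
  set T : RFun 2 := ⟨P, Q, hQ⟩ with hT
  have hNi' : EqOn N.integrand (T.pd i).fn N.domain := fun x hx => by
    rw [hNi hx, RFun.fn_apply]
    simp [RFun.pd, hT, map_sub, map_mul, map_pow]
  have e1 : of N - of (T.pd i).rep ∈ relations := of_box_sub_of_stokesExact_mem_relations i T N hNd hNi'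
  have hv1 : N.value = (T.pd i).rep.value := Equivalent.value_eq_holds e1
  have e2 : Equivalent (T.pd i).rep N' :=
    stokesExact_equivalent_dimLeOne_of_value_eq hm i T N' hN' (hv1.symm.trans hv)
  exact Equivalent.trans e1 e2

/-- **Conjecture 1 for two open-box representations with Stokes-exact integrands** (possibly along
different coordinates) of equal value. [cite: KontsevichZagier2001, §1.2 Conjecture 1] -/
theorem box_stokesExact_equivalent_of_value_eq (i j : Fin 2)
    (P Q : MvPolynomial (Fin 2) ℚ) (hQ : ∀ x ∈ KZ.cube 2, MvPolynomial.aeval x Q ≠ 0)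
    (P' Q' : MvPolynomial (Fin 2) ℚ) (hQ' : ∀ x ∈ KZ.cube 2, MvPolynomial.aeval x Q' ≠ 0)
    (N N' : IntegralRep 2) (hNd : N.domain = {x | ∀ i, x i ∈ Set.Ioo (0:ℝ) 1})
    (hNi : EqOn N.integrand (fun x =>
      (MvPolynomial.aeval x (MvPolynomial.pderiv i P) * MvPolynomial.aeval x Q -
        MvPolynomial.aeval x P * MvPolynomial.aeval x (MvPolynomial.pderiv i Q)) /
      (MvPolynomial.aeval x Q) ^ 2) N.domain)
    (hN'd : N'.domain = {x | ∀ i, x i ∈ Set.Ioo (0:ℝ) 1})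
    (hN'i : EqOn N'.integrand (fun x =>
      (MvPolynomial.aeval x (MvPolynomial.pderiv j P') * MvPolynomial.aeval x Q' -
        MvPolynomial.aeval x P' * MvPolynomial.aeval x (MvPolynomial.pderiv j Q')) /
      (MvPolynomial.aeval x Q') ^ 2) N'.domain)
    (hv : N.value = N'.value) : Equivalent N N' := by
  set T : RFun 2 := ⟨P, Q, hQ⟩ with hT
  set S : RFun 2 := ⟨P', Q', hQ'⟩ with hS
  have hNi₁ : EqOn N.integrand (T.pd i).fn N.domain := fun x hx => by
    rw [hNi hx, RFun.fn_apply]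
    simp [RFun.pd, hT, map_sub, map_mul, map_pow]
  have hNi₂ : EqOn N'.integrand (S.pd j).fn N'.domain := fun x hx => by
    rw [hN'i hx, RFun.fn_apply]
    simp [RFun.pd, hS, map_sub, map_mul, map_pow]
  have e1 := of_box_sub_of_stokesExact_mem_relations i T N hNd hNi₁
  have e2 := of_box_sub_of_stokesExact_mem_relations j S N' hN'd hNi₂
  have hv1 := Equivalent.value_eq_holds e1
  have hv2 := Equivalent.value_eq_holds e2
  have e3 : Equivalent (T.pd i).rep (S.pd j).rep :=
    stokesExact_equivalent_of_value_eq i j T S (by rw [← hv1, ← hv2, hv])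
  exact (Equivalent.trans e1 e3).trans (Equivalent.symm e2)

end Summit.KontsevichZagierPeriods.HurwitzMicroSectors.NormalFormPrinciple.PiBox.Stokes
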